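import Summits.QuantumFields.YangMills.Theorems.BalabanUVNodesN16LettersOfEdgesAllTorus
import Summits.QuantumFields.YangMills.Theorems.BalabanUVNodesN16H7OfReg9
import HarnessLib

/-!
# Route «BalabanUVNodes» (K3⁷ `SpineGivenEndpointR13SepCoPH`, stmt-QuantumFields-20544), DAG node N16 = NE3 — THE N07 → N16 EDGE RE-KEYED TO PRINT'S LOOSE DATA:
# N16's per-family closer (letters of record ∧ `InEndRegimeH` ∧ `LeafSlotHolderAT · β`) AT THE LOOSE-DATA OBJECT, from the N05 edge `h5` and the LOOSE leaf —
# hence from `h5` and [B11] THEOREM 1 at leaf-06's torus instances (displayed), with NO tight-window hypothesis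

Cell `pub-ymgap`, width seat `pub-ymgap-dag-n16-w1` (director-ym №197 ∕ HUMAN RULING D-0149), generation 3, file 6 — the CONSTRUCTIVE counterpart of file 5
(`…N16H7Fronts`: the tight half of `stub_h7` is model-false) executing, at the per-family level, the re-keying (C1)(i) of this lineage's located notes
(evidence #9∕#14∕#24 + `LOCATED-N16-H7-FRONTS.md` on stmt-QuantumFields-20544).  `--kind proof --supports stmt-QuantumFields-20544 --as helper` (count-neutral).
`bears_on: R4∕N16 · edge N07 → N16`.

THE POINT.  Module 37ᴴ's per-family step `…N16LettersOfEdgesAllTorus.exists_letters_inEndRegimeH_leafSlotHolderAT_of_edges` consumes N07's leaf `h7` ONCE, at the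
chosen radius `ℓ.ε`, and files it verbatim as the last conjunct `LeafH3sup 4 c.L c.Nper c.ε b' c' c.dom` of `LeafSlotHolderAT` — with `c.dom` = THE RECORD'S data
`ne3DomOfRecord₁₁ F N 0 0` (ALL `2L^m`-periodic `SU(N)` configurations).  Files 1–5 of this lineage located the obstruction: on that `dom` the linear leaf is
[Balaban1985Variational] Theorem 1 on the LOOSE data `V ∈ sfClass (ε∕B₃) 0` and FALSE (model) ∕ unprinted (print) on the tight window.  Since the three window
lemmas of the consumer chain (`exists_window_letters_linearLeaf`, `inEndRegimeH_ofRecord_of_window`, `leafSlotHolderAT_ofRecord_of_window_linear`) are GENERIC in the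
NE3 object `o : NE3Objects₁₁ N`, the whole per-family step goes through VERBATIM at the LOOSE-DATA OBJECT
`oL(ℓ, B) := { ne3ConstLayerOfRecord₁₁ F N ℓ with dom := {V | V ∈ ne3DomOfRecord₁₁ F N 0 0 ∧ V ∈ sfClass 4 F.L Nper (ℓ.ε∕B) 0} }` (same seven letters, same period;
only the data field shrinks to print's (7)-ball of the chosen radius) from `h5` and the LOOSE leaf
`h7L : ∃ C ε₀, 0 ≤ C ∧ 0 < ε₀ ∧ ∀ ε ∈ ]0,ε₀], LeafH3sup 4 F.L Nper ε (C·ε) (C·ε) {V ∈ dom | V ∈ sfClass (ε∕B) 0}` (§1), and `h7L` with `B = C.B₃` IS g0's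
`…N16H7OfReg9.h7Shape_loose_of_thm1At_torusVP` — [B11] Theorem 1 read at leaf-06's torus instances `∀ k, Thm1At C (torusVP 4 F.L Nper G (k+1))` with the (9)_{β₀=1}
interface binders (§2).  So, PER FAMILY, N16's closer holds AT THE LOOSE OBJECT from `h5` ∧ Theorem 1 (displayed) — no `stub_h7`, no AP-N16-2, no NO-BINDING.
What this does NOT do: the READING-level statement `S_N16Holder β (RRec₁₃CoPHOn (readingOfRecord₁₃CoPH w1 ℓ₃ ne2 ne1) Rg)` pins its objects through
`Node00.NE3Objects₁₁.ofRecord` (Literature, definer-owned) whose `dom` is the record's; re-keying THAT is the planners' (C1)(i) decision (one field of `ofRecord`, or a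
loose reading constructor) — recorded, not taken here.

WHAT THIS FILE PROVES (kernel, theorems only, 0 `def`, 0 sorry; BY NAME over landed modules).  §1 ★ `exists_letters_inEndRegimeH_leafSlotHolderAT_of_edges_loose`
(any displayed `B > 0`; β ∈ [0,1] free as in 37ᴴ's per-family lemma); §2 ★ `exists_letters_inEndRegimeH_leafSlotHolderAT_of_h5_thm1At` (`B = C.B₃`; hypotheses = `h5` +
leaf-06's `G, hGm, hG, C, hM, hT` exactly as in file 1 §3), `loose_dom_subset` (the loose object's data are data of record); §3 (v1.1) ★
`exists_letters_n16HolderAt_loose_of_edges` ∕ ★ `exists_letters_n16HolderAt_loose_of_h5_thm1At` — dag-n16-c's R-β NODE predicate `N16HolderAt · β` AT THE LOOSE CARRIER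
(n16-e's closer `n16HolderAt_of_inEndRegimeH_leafSlotHolderAT` BY NAME), from `h5` ∧ the loose leaf, resp. `h5` ∧ Theorem 1 at the torus instances.
§4 (v1.2) ★ `exists_letters_n16HolderAt_looseSub_of_edges` ∕ ★ `…_looseSub_of_h5_thm1At` — the same at ANY ℓ-dependent data set INSIDE the loose ball (the
leaf is antitone in the data, `leafH3sup_anti`) — the producer shape of K3⁷ v5's (β16) pin with a radius row; `minBall_subset_loose_and_b` (the `min(ℓ.ε∕B, ℓ.b)`-ball).

HONEST FRAMING.  Bookkeeping over landed theorems BY NAME; NOTHING of Bałaban is asserted (`h5` = N05∕N06 content, `Thm1At` = [B11] Theorem 1 for leaf-06's instances,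
both DISPLAYED hypotheses inhabited by nothing here; divergences D-s3-1…6 and AP-N16-1 of leaf-06 stand); `stub_h7` NOT closed; N16 NOT discharged at the record's
reading (the object here is the LOOSE one); count-neutral; counts of record unmoved (typed 28∕28 · discharged 5∕27); one finite four-torus at fixed `ε`, Bałaban AS
PRINTED — NOT ℝ⁴, NOT infinite volume, NOT OS, NOT a mass gap; the YM mass gap (Clay) is NOT proved by any of this — R4 closes the conditional finite-𝕋⁴ rung
`BalabanLadder.UV` only.
-/

set_option autoImplicit false

open scoped BigOperators Matrix Matrix.Norms.L2Operator
open NormedSpace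

namespace Summit.QuantumFields.YangMills.BalabanUVNodes.N16H7LooseOfThm1At

open Literature.MathematicalPhysics.QuantumFieldTheory.Balaban1983to89
open Literature.MathematicalPhysics.QuantumFieldTheory.Balaban1983to89.T4Continuum (T4Family)
open B7Prop1Explicit B7Prop2Explicit MatrixLog UnitaryModel
open T4AveragingDeficitWall hiding Site Plane Plaq Bond
open B7Prop3Flat (c3)
open B8LeafModelZd (ZdIdx)
open B8LeafModelZd3 (zdGF3)
open Node00 (NE3Objects₁₁ NE3Letters₁₁ ne3ConstLayerOfRecord₁₁ ne3NperOfRecord₁₁ ne3DomOfRecord₁₁ one_le_ne3NperOfRecord₁₁ MatA)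
open Summit.QuantumFields.BalabanUV.T4Continuum
open BlockAverageCurrent (curConst)
open NE3RightInverseSupLetters (frameC)
open NE3.LeafIndexSockets (LeafH3sup)
open MinimalActionRate (sfClass)
open MinimalActionDictionary (torusVP RadiiMono)
open AveragingDeficitLatticeH2Prep (fd)
open B11Thm1 (Thm1At)
open YMDAG.UVSplit (NE3Carriers ne3OfRecord₁₁)
open Summit.QuantumFields.YangMills.BalabanUVNodes.N16HolderRegime (InEndRegimeH radiusOfRecordH constOfRecordH radiusOfRecordH_pos)
open Summit.QuantumFields.YangMills.BalabanUVNodes.N16HolderSlotWindow (inEndRegimeH_ofRecord_of_window)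
open Summit.QuantumFields.YangMills.BalabanUVNodes.N16AtRecord13OfEdges (exists_window_letters_linearLeaf)
open Summit.QuantumFields.YangMills.BalabanUVNodes.N16LeafSlotAllTorus (LeafSlotHolderAT)
open Summit.QuantumFields.YangMills.BalabanUVNodes.N16SlotWindowAllTorus (leafSlotHolderAT_ofRecord_of_window_linear)
open Summit.QuantumFields.YangMills.BalabanUVNodes.N16H7OfReg9 (h7Shape_loose_of_thm1At_torusVP)

noncomputable section

variable {N : ℕ} [NeZero N]

/-! ## §1 Per family, R-β: the closer AT THE LOOSE-DATA OBJECT from `h5` and the loose leaf -/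

omit [NeZero N] in
/-- The loose object's data are data of record (its `dom` is the record's, cut by print's (7)-ball). [folklore] -/
theorem loose_dom_subset (F : T4Family) (ℓ : NE3Letters₁₁) (B : ℝ) :
    ({ ne3ConstLayerOfRecord₁₁ F N ℓ with
        dom := {V | V ∈ ne3DomOfRecord₁₁ F N 0 0 ∧ V ∈ sfClass 4 F.L (ne3NperOfRecord₁₁ F 0 0) (ℓ.ε / B) 0} } : NE3Objects₁₁ N).dom
      ⊆ ne3DomOfRecord₁₁ F N 0 0 :=
  fun _ hV => hV.1

variable {β : ℝ}

/-- **★ PER FAMILY, R-β, AT THE LOOSE-DATA OBJECT: LETTERS OF RECORD ∧ `InEndRegimeH` ∧ `LeafSlotHolderAT · β` FROM THE N05 EDGE AND THE LOOSE LEAF.**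
Hypotheses: a coupling letter `g > 0`; `h5` = N05's Thm-4 ∕ Prop-3 bodies on the all-torus proper pinned sub-family of `zdGF3 (M_N ℂ) F.L β len` with their constants
and window (VERBATIM 37ᴴ's `h5`); a displayed `B > 0`; and the LOOSE leaf `h7L : ∃ C ε₀, 0 ≤ C ∧ 0 < ε₀ ∧ ∀ ε ∈ ]0,ε₀], LeafH3sup 4 F.L Nper ε (C·ε) (C·ε)
{V | V ∈ ne3DomOfRecord₁₁ F N 0 0 ∧ V ∈ sfClass 4 F.L Nper (ε∕B) 0}`.  Conclusion: letters `ℓ` with `ℓ.g = g`, `ℓ.Λ₁ = radiusOfRecordH …`, `ℓ.C = constOfRecordH … g`,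
`0 < ℓ.b`, N21's numeral, `0 < ℓ.Λ₂'`, and `InEndRegimeH ∧ LeafSlotHolderAT · β` at `ne3OfRecord₁₁ F oL`, `oL = {ne3ConstLayerOfRecord₁₁ F N ℓ with dom := loose data
at radius ℓ.ε∕B}`.  Proof = 37ᴴ's per-family proof VERBATIM (its three window lemmas are generic in the object); the leaf is invoked once, at `ℓ.ε`. [folklore] -/
theorem exists_letters_inEndRegimeH_leafSlotHolderAT_of_edges_loose (F : T4Family) {g : ℝ} (hg : 0 < g)
    (h5 : letI : CStarAlgebra (Matrix (Fin N) (Fin N) ℂ) := {}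
      ∃ (len : Site 4 → ℝ) (c₁ c₁' B₁' cP C₂ B₀β : ℝ) (inp : B8.B9Inputs),
        (∀ v : Site 4, 0 < len v → 1 ≤ len v) ∧ (∀ μ : Fin 4, len (e μ) = 1) ∧ 0 < B₁' ∧ 5 * ((4 : ℕ) : ℝ) * F.L * inp.B₀ ≤ B₁' ∧ 0 < c₁' ∧
        (∀ α₀ α₁ : ℝ, 0 < α₀ → 0 < α₁ → α₀ + α₁ ≤ c₁' →
          α₀ + α₁ ≤ c₁ ∧ C0 4 * (2 * α₀) ≤ 1 / 3 ∧ 4 * α₀ ≤ c2' 4 F.L ∧ 16 * (B₁' * (α₀ + α₁)) ≤ 1 ∧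
          Real.exp (4 * (800 * (((4 : ℕ) : ℝ) + 1) ^ 2 * (((4 : ℕ) : ℝ) + 4)) * α₀) * (1 + 8 * (131072 * (((4 : ℕ) : ℝ) + 1) ^ 2) * (B₁' * (α₀ + α₁))) ≤ 2 ∧
          2 * (B₁' * (α₀ + α₁)) ≤ c3 4 F.L ∧ ((4 : ℕ) : ℝ) * F.L * α₁ ≤ 1 / 8 ∧ α₀ ≤ cP ∧ α₁ ≤ cP ∧ B₁' * (α₀ + α₁) ≤ cP ∧
          2 * (B₁' * (α₀ + α₁)) ^ 2 + 20 * ((4 : ℕ) : ℝ) * α₀ * (B₁' * (α₀ + α₁)) + 2 * C₂ * (B₁' * (α₀ + α₁)) ^ 2 ≤ α₀ + α₁) ∧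
        B8.Thm4Body c₁ B₁' (fun i : {i : ZdIdx 4 F.L // (∀ j, i.Ω j = Set.univ) ∧ (∀ m j, i.Λs m j = {_y | j = m}) ∧ (∀ m j, i.Λb m j = {_c | j = m}) ∧ i.η = ((F.L : ℝ)⁻¹) ^ i.k} => (zdGF3 (Matrix (Fin N) (Fin N) ℂ) F.L β len i.1).toGFData) ∧
        B8.Prop3Body cP 4 (F.L : ℝ) C₂ inp B₀β (fun i : {i : ZdIdx 4 F.L // (∀ j, i.Ω j = Set.univ) ∧ (∀ m j, i.Λs m j = {_y | j = m}) ∧ (∀ m j, i.Λb m j = {_c | j = m}) ∧ i.η = ((F.L : ℝ)⁻¹) ^ i.k} => (zdGF3 (Matrix (Fin N) (Fin N) ℂ) F.L β len i.1).toGFData2))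
    {B : ℝ}
    (h7L : ∃ C ε₀ : ℝ, 0 ≤ C ∧ 0 < ε₀ ∧ ∀ ε : ℝ, 0 < ε → ε ≤ ε₀ →
      LeafH3sup 4 F.L (ne3NperOfRecord₁₁ F 0 0) ε (C * ε) (C * ε)
        {V | V ∈ ne3DomOfRecord₁₁ F N 0 0 ∧ V ∈ sfClass 4 F.L (ne3NperOfRecord₁₁ F 0 0) (ε / B) 0}) :
    ∃ ℓ : NE3Letters₁₁, ℓ.g = g ∧ ℓ.Λ₁ = radiusOfRecordH N F.L (ne3NperOfRecord₁₁ F 0 0) ∧ ℓ.C = constOfRecordH N F.L (ne3NperOfRecord₁₁ F 0 0) g ∧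
      0 < ℓ.b ∧ 512 * (4 + 1) * (4 + 4) * (F.L : ℝ) ^ 2 * ℓ.b ≤ 1 ∧ 0 < ℓ.Λ₂' ∧
      InEndRegimeH (ne3OfRecord₁₁ F
        { ne3ConstLayerOfRecord₁₁ F N ℓ with
          dom := {V | V ∈ ne3DomOfRecord₁₁ F N 0 0 ∧ V ∈ sfClass 4 F.L (ne3NperOfRecord₁₁ F 0 0) (ℓ.ε / B) 0} }) ∧
      LeafSlotHolderAT (ne3OfRecord₁₁ F
        { ne3ConstLayerOfRecord₁₁ F N ℓ with
          dom := {V | V ∈ ne3DomOfRecord₁₁ F N 0 0 ∧ V ∈ sfClass 4 F.L (ne3NperOfRecord₁₁ F 0 0) (ℓ.ε / B) 0} }) β := by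
  letI : CStarAlgebra (Matrix (Fin N) (Fin N) ℂ) := {}
  obtain ⟨len, c₁, c₁', B₁', cP, C₂, B₀β, inp, hlen, hlen1, hB₁', hBB, hc₁', hwin, hT, hP⟩ := h5
  obtain ⟨C, ε₀, hC, hε₀, h3⟩ := h7L
  have hL : 2 ≤ F.L := HistoryFlow.two_le_L F
  obtain ⟨α, ℓ, hα, hα1, hα2, hα3, hα4, hα5, hgℓ, hε0, hε, hεε₀, hCε, hεr, hΛ₁, hb0, hb, hCℓ, hΛ₂', hΛ₂'0, hnum⟩ :=
    exists_window_letters_linearLeaf F hc₁' inp B₀β g (radiusOfRecordH_pos (N := N) hL (one_le_ne3NperOfRecord₁₁ F 0 0))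
      (constOfRecordH N F.L (ne3NperOfRecord₁₁ F 0 0) g) hC hε₀
  -- the loose-data object at the chosen radius: same letters and period as the const layer of record, data cut by the (7)-ball `sfClass (ℓ.ε∕B) 0`
  set oL : NE3Objects₁₁ N := { ne3ConstLayerOfRecord₁₁ F N ℓ with
      dom := {V | V ∈ ne3DomOfRecord₁₁ F N 0 0 ∧ V ∈ sfClass 4 F.L (ne3NperOfRecord₁₁ F 0 0) (ℓ.ε / B) 0} } with hoL
  have hB0 : 0 < 5 * ((4 : ℕ) : ℝ) * F.L * inp.B₀ := by have := inp.B₀_pos; positivity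
  have hΛpos : 0 < ℓ.Λ₁ := by rw [hΛ₁]; exact radiusOfRecordH_pos (N := N) hL (one_le_ne3NperOfRecord₁₁ F 0 0)
  have hgpos : 0 < ℓ.g := by rw [hgℓ]; exact hg
  refine ⟨ℓ, hgℓ, hΛ₁, hCℓ, hb0, hnum, hΛ₂'0,
    inEndRegimeH_ofRecord_of_window F oL (one_le_ne3NperOfRecord₁₁ F 0 0) hgpos hB0.le hα2 hε0 hε hΛ₁.le hb0.le hb
      (show constOfRecordH N F.L (ne3NperOfRecord₁₁ F 0 0) ℓ.g ≤ ℓ.C by rw [hCℓ, hgℓ]), ?_⟩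
  have hCε0 : 0 ≤ C * ℓ.ε := mul_nonneg hC hε0.le
  exact leafSlotHolderAT_ofRecord_of_window_linear F oL hlen hlen1 hB₁' hBB hc₁' hwin hα hα1 hα2 hα3 hα4 hα5 hε hΛpos hΛ₂' hCε0 hCε hCε0
    (hCε.trans (by linarith only [hα.le] : α / 2048 ≤ α / 24)) hT hP (h3 ℓ.ε hε0 hεε₀)

/-! ## §2 Per family, R-β: the closer AT THE LOOSE-DATA OBJECT from `h5` and [B11] THEOREM 1 at leaf-06's torus instances -/

/-- **★ PER FAMILY, R-β, AT THE LOOSE-DATA OBJECT — FROM `h5` AND THEOREM 1 (DISPLAYED), NO `stub_h7`.**  Hypotheses: `g > 0`, `h5` (as in §1), and leaf-06's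
Theorem-1 reading exactly as in file 1 §3 — a local-gauge shape `G` monotone in its radii (`RadiiMono`) with the (9)_{β₀=1} interface binder `hG`, constants
`C : B11Thm1.Consts` with `M(ε₁) ≥ 7∕2` on `(0,a₁]`, and `hT : ∀ k, Thm1At C (torusVP 4 F.L Nper G (k+1))` ([Balaban1985Variational] Thm 1 p. 279 for the torus
instances of `MinimalActionDictionary` §4 — asserted for nothing).  Conclusion: §1's, at the loose object of radius `ℓ.ε∕C.B₃`.  Proof: §1 ∘ file 1's
`h7Shape_loose_of_thm1At_torusVP` (C′ = 16937, ε₀ = min(B₃a₁, 1∕28)). [cite: Balaban1985Variational, Thm 1 (8)–(10) p.279] -/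
theorem exists_letters_inEndRegimeH_leafSlotHolderAT_of_h5_thm1At (F : T4Family) {g : ℝ} (hg : 0 < g)
    (h5 : letI : CStarAlgebra (Matrix (Fin N) (Fin N) ℂ) := {}
      ∃ (len : Site 4 → ℝ) (c₁ c₁' B₁' cP C₂ B₀β : ℝ) (inp : B8.B9Inputs),
        (∀ v : Site 4, 0 < len v → 1 ≤ len v) ∧ (∀ μ : Fin 4, len (e μ) = 1) ∧ 0 < B₁' ∧ 5 * ((4 : ℕ) : ℝ) * F.L * inp.B₀ ≤ B₁' ∧ 0 < c₁' ∧
        (∀ α₀ α₁ : ℝ, 0 < α₀ → 0 < α₁ → α₀ + α₁ ≤ c₁' →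
          α₀ + α₁ ≤ c₁ ∧ C0 4 * (2 * α₀) ≤ 1 / 3 ∧ 4 * α₀ ≤ c2' 4 F.L ∧ 16 * (B₁' * (α₀ + α₁)) ≤ 1 ∧
          Real.exp (4 * (800 * (((4 : ℕ) : ℝ) + 1) ^ 2 * (((4 : ℕ) : ℝ) + 4)) * α₀) * (1 + 8 * (131072 * (((4 : ℕ) : ℝ) + 1) ^ 2) * (B₁' * (α₀ + α₁))) ≤ 2 ∧
          2 * (B₁' * (α₀ + α₁)) ≤ c3 4 F.L ∧ ((4 : ℕ) : ℝ) * F.L * α₁ ≤ 1 / 8 ∧ α₀ ≤ cP ∧ α₁ ≤ cP ∧ B₁' * (α₀ + α₁) ≤ cP ∧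
          2 * (B₁' * (α₀ + α₁)) ^ 2 + 20 * ((4 : ℕ) : ℝ) * α₀ * (B₁' * (α₀ + α₁)) + 2 * C₂ * (B₁' * (α₀ + α₁)) ^ 2 ≤ α₀ + α₁) ∧
        B8.Thm4Body c₁ B₁' (fun i : {i : ZdIdx 4 F.L // (∀ j, i.Ω j = Set.univ) ∧ (∀ m j, i.Λs m j = {_y | j = m}) ∧ (∀ m j, i.Λb m j = {_c | j = m}) ∧ i.η = ((F.L : ℝ)⁻¹) ^ i.k} => (zdGF3 (Matrix (Fin N) (Fin N) ℂ) F.L β len i.1).toGFData) ∧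
        B8.Prop3Body cP 4 (F.L : ℝ) C₂ inp B₀β (fun i : {i : ZdIdx 4 F.L // (∀ j, i.Ω j = Set.univ) ∧ (∀ m j, i.Λs m j = {_y | j = m}) ∧ (∀ m j, i.Λb m j = {_c | j = m}) ∧ i.η = ((F.L : ℝ)⁻¹) ^ i.k} => (zdGF3 (Matrix (Fin N) (Fin N) ℂ) F.L β len i.1).toGFData2))
    {G : (Site 4 → Fin 4 → (MatA N)ˣ) → Site 4 → ℕ → ℝ → ℝ → ℝ → Prop} (hGm : RadiiMono 4 G)
    (hG : ∀ (U : Site 4 → Fin 4 → (MatA N)ˣ) (x : Site 4) (K : ℕ) (α₀ α₁ α₂ : ℝ), 2 ≤ K → G U x K α₀ α₁ α₂ →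
      ∃ (u : Site 4 → (MatA N)ˣ) (a : Site 4 → Fin 4 → MatA N),
        (∀ z, u z ∈ unitaryUnits (MatA N)) ∧
        (∀ (y : Site 4) (τ : Fin 4), l1 (y - x) ≤ 2 → ((gaugeAct u U y τ : (MatA N)ˣ) : MatA N) = exp (a y τ)) ∧
        (∀ (y : Site 4) (τ : Fin 4), l1 (y - x) ≤ 2 → ‖a y τ‖ ≤ α₀) ∧
        (∀ (y : Site 4) (τ i : Fin 4), l1 (y - x) ≤ 1 → ‖fd i (fun z => a z τ) y‖ ≤ α₁) ∧
        (∀ (τ i l : Fin 4), ‖fd i (fd l (fun z => a z τ)) x‖ ≤ α₂))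
    (C : B11Thm1.Consts) (hM : ∀ e : ℝ, 0 < e → e ≤ C.a₁ → 7 / 2 ≤ C.Mfun e)
    (hT : ∀ k : ℕ, Thm1At C (torusVP 4 F.L (ne3NperOfRecord₁₁ F 0 0) G (k + 1))) :
    ∃ ℓ : NE3Letters₁₁, ℓ.g = g ∧ ℓ.Λ₁ = radiusOfRecordH N F.L (ne3NperOfRecord₁₁ F 0 0) ∧ ℓ.C = constOfRecordH N F.L (ne3NperOfRecord₁₁ F 0 0) g ∧
      0 < ℓ.b ∧ 512 * (4 + 1) * (4 + 4) * (F.L : ℝ) ^ 2 * ℓ.b ≤ 1 ∧ 0 < ℓ.Λ₂' ∧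
      InEndRegimeH (ne3OfRecord₁₁ F
        { ne3ConstLayerOfRecord₁₁ F N ℓ with
          dom := {V | V ∈ ne3DomOfRecord₁₁ F N 0 0 ∧ V ∈ sfClass 4 F.L (ne3NperOfRecord₁₁ F 0 0) (ℓ.ε / C.B₃) 0} }) ∧
      LeafSlotHolderAT (ne3OfRecord₁₁ F
        { ne3ConstLayerOfRecord₁₁ F N ℓ with
          dom := {V | V ∈ ne3DomOfRecord₁₁ F N 0 0 ∧ V ∈ sfClass 4 F.L (ne3NperOfRecord₁₁ F 0 0) (ℓ.ε / C.B₃) 0} }) β :=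
  exists_letters_inEndRegimeH_leafSlotHolderAT_of_edges_loose F hg h5
    (h7Shape_loose_of_thm1At_torusVP (le_trans one_le_two (HistoryFlow.two_le_L F)) hGm hG C hM hT (ne3DomOfRecord₁₁ F N 0 0))

/-! ## §3 (v1.1) The NODE statement `N16HolderAt · β` AT THE LOOSE-DATA CARRIER -/

section NodeStatement

open Summit.QuantumFields.YangMills.BalabanUVNodes.N16HolderDefs (N16HolderAt)
open Summit.QuantumFields.YangMills.BalabanUVNodes.N16LeafSlotAllTorus (n16HolderAt_of_inEndRegimeH_leafSlotHolderAT)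

/-- **★ N16'S R-β NODE STATEMENT AT THE LOOSE-DATA CARRIER, FROM THE N05 EDGE AND THE LOOSE LEAF** (`0 ≤ β ≤ 1`): §1's letters `ℓ` carry, besides the letters of
record and N21's numerals, `N16HolderAt (ne3OfRecord₁₁ F oL) β` — dag-n16-c's R-β node predicate (`…N16HolderDefs.N16HolderAt`, = `CovRootHolder 4 (sfClass …) … β c.dom`)
read at the loose carrier `oL = {ne3ConstLayerOfRecord₁₁ F N ℓ with dom := loose data at radius ℓ.ε∕B}` — by n16-e's closer of record
`…N16LeafSlotAllTorus.n16HolderAt_of_inEndRegimeH_leafSlotHolderAT` BY NAME (generic in the carrier).  This is what 37ᴴ feeds, per family, into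
`S_N16Holder β (RRec₁₃CoPHOn …)` — there at the record's carrier; here at the loose one.  Nothing of Bałaban asserted (`h5`, `h7L` displayed). [folklore] -/
theorem exists_letters_n16HolderAt_loose_of_edges (F : T4Family) (hβ0 : 0 ≤ β) (hβ1 : β ≤ 1) {g : ℝ} (hg : 0 < g)
    (h5 : letI : CStarAlgebra (Matrix (Fin N) (Fin N) ℂ) := {}
      ∃ (len : Site 4 → ℝ) (c₁ c₁' B₁' cP C₂ B₀β : ℝ) (inp : B8.B9Inputs),
        (∀ v : Site 4, 0 < len v → 1 ≤ len v) ∧ (∀ μ : Fin 4, len (e μ) = 1) ∧ 0 < B₁' ∧ 5 * ((4 : ℕ) : ℝ) * F.L * inp.B₀ ≤ B₁' ∧ 0 < c₁' ∧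
        (∀ α₀ α₁ : ℝ, 0 < α₀ → 0 < α₁ → α₀ + α₁ ≤ c₁' →
          α₀ + α₁ ≤ c₁ ∧ C0 4 * (2 * α₀) ≤ 1 / 3 ∧ 4 * α₀ ≤ c2' 4 F.L ∧ 16 * (B₁' * (α₀ + α₁)) ≤ 1 ∧
          Real.exp (4 * (800 * (((4 : ℕ) : ℝ) + 1) ^ 2 * (((4 : ℕ) : ℝ) + 4)) * α₀) * (1 + 8 * (131072 * (((4 : ℕ) : ℝ) + 1) ^ 2) * (B₁' * (α₀ + α₁))) ≤ 2 ∧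
          2 * (B₁' * (α₀ + α₁)) ≤ c3 4 F.L ∧ ((4 : ℕ) : ℝ) * F.L * α₁ ≤ 1 / 8 ∧ α₀ ≤ cP ∧ α₁ ≤ cP ∧ B₁' * (α₀ + α₁) ≤ cP ∧
          2 * (B₁' * (α₀ + α₁)) ^ 2 + 20 * ((4 : ℕ) : ℝ) * α₀ * (B₁' * (α₀ + α₁)) + 2 * C₂ * (B₁' * (α₀ + α₁)) ^ 2 ≤ α₀ + α₁) ∧
        B8.Thm4Body c₁ B₁' (fun i : {i : ZdIdx 4 F.L // (∀ j, i.Ω j = Set.univ) ∧ (∀ m j, i.Λs m j = {_y | j = m}) ∧ (∀ m j, i.Λb m j = {_c | j = m}) ∧ i.η = ((F.L : ℝ)⁻¹) ^ i.k} => (zdGF3 (Matrix (Fin N) (Fin N) ℂ) F.L β len i.1).toGFData) ∧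
        B8.Prop3Body cP 4 (F.L : ℝ) C₂ inp B₀β (fun i : {i : ZdIdx 4 F.L // (∀ j, i.Ω j = Set.univ) ∧ (∀ m j, i.Λs m j = {_y | j = m}) ∧ (∀ m j, i.Λb m j = {_c | j = m}) ∧ i.η = ((F.L : ℝ)⁻¹) ^ i.k} => (zdGF3 (Matrix (Fin N) (Fin N) ℂ) F.L β len i.1).toGFData2))
    {B : ℝ}
    (h7L : ∃ C ε₀ : ℝ, 0 ≤ C ∧ 0 < ε₀ ∧ ∀ ε : ℝ, 0 < ε → ε ≤ ε₀ →
      LeafH3sup 4 F.L (ne3NperOfRecord₁₁ F 0 0) ε (C * ε) (C * ε)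
        {V | V ∈ ne3DomOfRecord₁₁ F N 0 0 ∧ V ∈ sfClass 4 F.L (ne3NperOfRecord₁₁ F 0 0) (ε / B) 0}) :
    ∃ ℓ : NE3Letters₁₁, ℓ.g = g ∧ ℓ.Λ₁ = radiusOfRecordH N F.L (ne3NperOfRecord₁₁ F 0 0) ∧ ℓ.C = constOfRecordH N F.L (ne3NperOfRecord₁₁ F 0 0) g ∧
      0 < ℓ.b ∧ 512 * (4 + 1) * (4 + 4) * (F.L : ℝ) ^ 2 * ℓ.b ≤ 1 ∧ 0 < ℓ.Λ₂' ∧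
      N16HolderAt (ne3OfRecord₁₁ F
        { ne3ConstLayerOfRecord₁₁ F N ℓ with
          dom := {V | V ∈ ne3DomOfRecord₁₁ F N 0 0 ∧ V ∈ sfClass 4 F.L (ne3NperOfRecord₁₁ F 0 0) (ℓ.ε / B) 0} }) β := by
  obtain ⟨ℓ, hgℓ, hΛ₁, hCℓ, hb0, hnum, hΛ₂'0, hreg, hslot⟩ := exists_letters_inEndRegimeH_leafSlotHolderAT_of_edges_loose F hg h5 h7L
  exact ⟨ℓ, hgℓ, hΛ₁, hCℓ, hb0, hnum, hΛ₂'0, n16HolderAt_of_inEndRegimeH_leafSlotHolderAT hreg hβ0 hβ1 hslot⟩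

/-- **★ N16'S R-β NODE STATEMENT AT THE LOOSE-DATA CARRIER FROM `h5` AND [B11] THEOREM 1 AT leaf-06's TORUS INSTANCES** (`0 ≤ β ≤ 1`; `B = C.B₃`): §2 pushed through
n16-e's closer of record.  Per family, the N07 → N16 edge costs NOTHING beyond Theorem 1 read at the torus instances (displayed `hT`), once N16 is read at loose
data; `stub_h7`, AP-N16-2 and NO-BINDING do not occur.  Nothing of Bałaban asserted. [cite: Balaban1985Variational, Thm 1 (8)–(10) p.279] -/
theorem exists_letters_n16HolderAt_loose_of_h5_thm1At (F : T4Family) (hβ0 : 0 ≤ β) (hβ1 : β ≤ 1) {g : ℝ} (hg : 0 < g)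
    (h5 : letI : CStarAlgebra (Matrix (Fin N) (Fin N) ℂ) := {}
      ∃ (len : Site 4 → ℝ) (c₁ c₁' B₁' cP C₂ B₀β : ℝ) (inp : B8.B9Inputs),
        (∀ v : Site 4, 0 < len v → 1 ≤ len v) ∧ (∀ μ : Fin 4, len (e μ) = 1) ∧ 0 < B₁' ∧ 5 * ((4 : ℕ) : ℝ) * F.L * inp.B₀ ≤ B₁' ∧ 0 < c₁' ∧
        (∀ α₀ α₁ : ℝ, 0 < α₀ → 0 < α₁ → α₀ + α₁ ≤ c₁' →
          α₀ + α₁ ≤ c₁ ∧ C0 4 * (2 * α₀) ≤ 1 / 3 ∧ 4 * α₀ ≤ c2' 4 F.L ∧ 16 * (B₁' * (α₀ + α₁)) ≤ 1 ∧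
          Real.exp (4 * (800 * (((4 : ℕ) : ℝ) + 1) ^ 2 * (((4 : ℕ) : ℝ) + 4)) * α₀) * (1 + 8 * (131072 * (((4 : ℕ) : ℝ) + 1) ^ 2) * (B₁' * (α₀ + α₁))) ≤ 2 ∧
          2 * (B₁' * (α₀ + α₁)) ≤ c3 4 F.L ∧ ((4 : ℕ) : ℝ) * F.L * α₁ ≤ 1 / 8 ∧ α₀ ≤ cP ∧ α₁ ≤ cP ∧ B₁' * (α₀ + α₁) ≤ cP ∧
          2 * (B₁' * (α₀ + α₁)) ^ 2 + 20 * ((4 : ℕ) : ℝ) * α₀ * (B₁' * (α₀ + α₁)) + 2 * C₂ * (B₁' * (α₀ + α₁)) ^ 2 ≤ α₀ + α₁) ∧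
        B8.Thm4Body c₁ B₁' (fun i : {i : ZdIdx 4 F.L // (∀ j, i.Ω j = Set.univ) ∧ (∀ m j, i.Λs m j = {_y | j = m}) ∧ (∀ m j, i.Λb m j = {_c | j = m}) ∧ i.η = ((F.L : ℝ)⁻¹) ^ i.k} => (zdGF3 (Matrix (Fin N) (Fin N) ℂ) F.L β len i.1).toGFData) ∧
        B8.Prop3Body cP 4 (F.L : ℝ) C₂ inp B₀β (fun i : {i : ZdIdx 4 F.L // (∀ j, i.Ω j = Set.univ) ∧ (∀ m j, i.Λs m j = {_y | j = m}) ∧ (∀ m j, i.Λb m j = {_c | j = m}) ∧ i.η = ((F.L : ℝ)⁻¹) ^ i.k} => (zdGF3 (Matrix (Fin N) (Fin N) ℂ) F.L β len i.1).toGFData2))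
    {G : (Site 4 → Fin 4 → (MatA N)ˣ) → Site 4 → ℕ → ℝ → ℝ → ℝ → Prop} (hGm : RadiiMono 4 G)
    (hG : ∀ (U : Site 4 → Fin 4 → (MatA N)ˣ) (x : Site 4) (K : ℕ) (α₀ α₁ α₂ : ℝ), 2 ≤ K → G U x K α₀ α₁ α₂ →
      ∃ (u : Site 4 → (MatA N)ˣ) (a : Site 4 → Fin 4 → MatA N),
        (∀ z, u z ∈ unitaryUnits (MatA N)) ∧
        (∀ (y : Site 4) (τ : Fin 4), l1 (y - x) ≤ 2 → ((gaugeAct u U y τ : (MatA N)ˣ) : MatA N) = exp (a y τ)) ∧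
        (∀ (y : Site 4) (τ : Fin 4), l1 (y - x) ≤ 2 → ‖a y τ‖ ≤ α₀) ∧
        (∀ (y : Site 4) (τ i : Fin 4), l1 (y - x) ≤ 1 → ‖fd i (fun z => a z τ) y‖ ≤ α₁) ∧
        (∀ (τ i l : Fin 4), ‖fd i (fd l (fun z => a z τ)) x‖ ≤ α₂))
    (C : B11Thm1.Consts) (hM : ∀ e : ℝ, 0 < e → e ≤ C.a₁ → 7 / 2 ≤ C.Mfun e)
    (hT : ∀ k : ℕ, Thm1At C (torusVP 4 F.L (ne3NperOfRecord₁₁ F 0 0) G (k + 1))) :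
    ∃ ℓ : NE3Letters₁₁, ℓ.g = g ∧ ℓ.Λ₁ = radiusOfRecordH N F.L (ne3NperOfRecord₁₁ F 0 0) ∧ ℓ.C = constOfRecordH N F.L (ne3NperOfRecord₁₁ F 0 0) g ∧
      0 < ℓ.b ∧ 512 * (4 + 1) * (4 + 4) * (F.L : ℝ) ^ 2 * ℓ.b ≤ 1 ∧ 0 < ℓ.Λ₂' ∧
      N16HolderAt (ne3OfRecord₁₁ F
        { ne3ConstLayerOfRecord₁₁ F N ℓ with
          dom := {V | V ∈ ne3DomOfRecord₁₁ F N 0 0 ∧ V ∈ sfClass 4 F.L (ne3NperOfRecord₁₁ F 0 0) (ℓ.ε / C.B₃) 0} }) β :=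
  exists_letters_n16HolderAt_loose_of_edges F hβ0 hβ1 hg h5
    (h7Shape_loose_of_thm1At_torusVP (le_trans one_le_two (HistoryFlow.two_le_L F)) hGm hG C hM hT (ne3DomOfRecord₁₁ F N 0 0))

end NodeStatement

/-! ## §4 (v1.2) ANY ℓ-DEPENDENT DATA SET INSIDE THE (7)-BALL (the leaf is antitone in the data): the producer for K3⁷ v5's (β16) pin with a radius row -/

section LooseSub

open Summit.QuantumFields.YangMills.BalabanUVNodes.N16HolderDefs (N16HolderAt)
open Summit.QuantumFields.YangMills.BalabanUVNodes.N16LeafSlotAllTorus (n16HolderAt_of_inEndRegimeH_leafSlotHolderAT)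
open Summit.QuantumFields.YangMills.BalabanUVNodes.N16H7OfReg9 (leafH3sup_anti)

/-- **★ PER FAMILY, R-β, AT ANY DATA SET INSIDE THE LOOSE BALL: LETTERS ∧ `InEndRegimeH` ∧ `LeafSlotHolderAT · β` ∧ `N16HolderAt · β`, FROM `h5` AND THE LOOSE LEAF.**
As §1∕§3 but the NE3 object's data field is an ARBITRARY ℓ-dependent set `D ℓ ⊆ {V ∈ ne3DomOfRecord₁₁ F N 0 0 | V ∈ sfClass 4 F.L Nper (ℓ.ε∕B) 0}` — e.g. the
(β16) pin's `min(ℓ.ε∕B₃, ℓ.b)`-ball that node N19's link reading asks of N16's data (dag-n16-e DATUM-C1): the leaf is ANTITONE in the data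
(`…N16H7OfReg9.leafH3sup_anti`), so the loose leaf at radius `ℓ.ε∕B` serves every smaller data set; the window lemmas are generic in the object (§1).
Nothing of Bałaban asserted (`h5`, `h7L` displayed). [folklore] -/
theorem exists_letters_n16HolderAt_looseSub_of_edges (F : T4Family) (hβ0 : 0 ≤ β) (hβ1 : β ≤ 1) {g : ℝ} (hg : 0 < g)
    (h5 : letI : CStarAlgebra (Matrix (Fin N) (Fin N) ℂ) := {}
      ∃ (len : Site 4 → ℝ) (c₁ c₁' B₁' cP C₂ B₀β : ℝ) (inp : B8.B9Inputs),
        (∀ v : Site 4, 0 < len v → 1 ≤ len v) ∧ (∀ μ : Fin 4, len (e μ) = 1) ∧ 0 < B₁' ∧ 5 * ((4 : ℕ) : ℝ) * F.L * inp.B₀ ≤ B₁' ∧ 0 < c₁' ∧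
        (∀ α₀ α₁ : ℝ, 0 < α₀ → 0 < α₁ → α₀ + α₁ ≤ c₁' →
          α₀ + α₁ ≤ c₁ ∧ C0 4 * (2 * α₀) ≤ 1 / 3 ∧ 4 * α₀ ≤ c2' 4 F.L ∧ 16 * (B₁' * (α₀ + α₁)) ≤ 1 ∧
          Real.exp (4 * (800 * (((4 : ℕ) : ℝ) + 1) ^ 2 * (((4 : ℕ) : ℝ) + 4)) * α₀) * (1 + 8 * (131072 * (((4 : ℕ) : ℝ) + 1) ^ 2) * (B₁' * (α₀ + α₁))) ≤ 2 ∧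
          2 * (B₁' * (α₀ + α₁)) ≤ c3 4 F.L ∧ ((4 : ℕ) : ℝ) * F.L * α₁ ≤ 1 / 8 ∧ α₀ ≤ cP ∧ α₁ ≤ cP ∧ B₁' * (α₀ + α₁) ≤ cP ∧
          2 * (B₁' * (α₀ + α₁)) ^ 2 + 20 * ((4 : ℕ) : ℝ) * α₀ * (B₁' * (α₀ + α₁)) + 2 * C₂ * (B₁' * (α₀ + α₁)) ^ 2 ≤ α₀ + α₁) ∧
        B8.Thm4Body c₁ B₁' (fun i : {i : ZdIdx 4 F.L // (∀ j, i.Ω j = Set.univ) ∧ (∀ m j, i.Λs m j = {_y | j = m}) ∧ (∀ m j, i.Λb m j = {_c | j = m}) ∧ i.η = ((F.L : ℝ)⁻¹) ^ i.k} => (zdGF3 (Matrix (Fin N) (Fin N) ℂ) F.L β len i.1).toGFData) ∧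
        B8.Prop3Body cP 4 (F.L : ℝ) C₂ inp B₀β (fun i : {i : ZdIdx 4 F.L // (∀ j, i.Ω j = Set.univ) ∧ (∀ m j, i.Λs m j = {_y | j = m}) ∧ (∀ m j, i.Λb m j = {_c | j = m}) ∧ i.η = ((F.L : ℝ)⁻¹) ^ i.k} => (zdGF3 (Matrix (Fin N) (Fin N) ℂ) F.L β len i.1).toGFData2))
    {B : ℝ} (D : NE3Letters₁₁ → Set (Site 4 → Fin 4 → (MatA N)ˣ))
    (hD : ∀ ℓ : NE3Letters₁₁, D ℓ ⊆ {V | V ∈ ne3DomOfRecord₁₁ F N 0 0 ∧ V ∈ sfClass 4 F.L (ne3NperOfRecord₁₁ F 0 0) (ℓ.ε / B) 0})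
    (h7L : ∃ C ε₀ : ℝ, 0 ≤ C ∧ 0 < ε₀ ∧ ∀ ε : ℝ, 0 < ε → ε ≤ ε₀ →
      LeafH3sup 4 F.L (ne3NperOfRecord₁₁ F 0 0) ε (C * ε) (C * ε)
        {V | V ∈ ne3DomOfRecord₁₁ F N 0 0 ∧ V ∈ sfClass 4 F.L (ne3NperOfRecord₁₁ F 0 0) (ε / B) 0}) :
    ∃ ℓ : NE3Letters₁₁, ℓ.g = g ∧ ℓ.Λ₁ = radiusOfRecordH N F.L (ne3NperOfRecord₁₁ F 0 0) ∧ ℓ.C = constOfRecordH N F.L (ne3NperOfRecord₁₁ F 0 0) g ∧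
      0 < ℓ.b ∧ 512 * (4 + 1) * (4 + 4) * (F.L : ℝ) ^ 2 * ℓ.b ≤ 1 ∧ 0 < ℓ.Λ₂' ∧
      InEndRegimeH (ne3OfRecord₁₁ F { ne3ConstLayerOfRecord₁₁ F N ℓ with dom := D ℓ }) ∧
      LeafSlotHolderAT (ne3OfRecord₁₁ F { ne3ConstLayerOfRecord₁₁ F N ℓ with dom := D ℓ }) β ∧
      N16HolderAt (ne3OfRecord₁₁ F { ne3ConstLayerOfRecord₁₁ F N ℓ with dom := D ℓ }) β := by
  letI : CStarAlgebra (Matrix (Fin N) (Fin N) ℂ) := {}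
  obtain ⟨len, c₁, c₁', B₁', cP, C₂, B₀β, inp, hlen, hlen1, hB₁', hBB, hc₁', hwin, hT, hP⟩ := h5
  obtain ⟨C, ε₀, hC, hε₀, h3⟩ := h7L
  have hL : 2 ≤ F.L := HistoryFlow.two_le_L F
  obtain ⟨α, ℓ, hα, hα1, hα2, hα3, hα4, hα5, hgℓ, hε0, hε, hεε₀, hCε, hεr, hΛ₁, hb0, hb, hCℓ, hΛ₂', hΛ₂'0, hnum⟩ :=
    exists_window_letters_linearLeaf F hc₁' inp B₀β g (radiusOfRecordH_pos (N := N) hL (one_le_ne3NperOfRecord₁₁ F 0 0))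
      (constOfRecordH N F.L (ne3NperOfRecord₁₁ F 0 0) g) hC hε₀
  set oD : NE3Objects₁₁ N := { ne3ConstLayerOfRecord₁₁ F N ℓ with dom := D ℓ } with hoD
  have hB0 : 0 < 5 * ((4 : ℕ) : ℝ) * F.L * inp.B₀ := by have := inp.B₀_pos; positivity
  have hΛpos : 0 < ℓ.Λ₁ := by rw [hΛ₁]; exact radiusOfRecordH_pos (N := N) hL (one_le_ne3NperOfRecord₁₁ F 0 0)
  have hgpos : 0 < ℓ.g := by rw [hgℓ]; exact hg
  have hreg : InEndRegimeH (ne3OfRecord₁₁ F oD) :=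
    inEndRegimeH_ofRecord_of_window F oD (one_le_ne3NperOfRecord₁₁ F 0 0) hgpos hB0.le hα2 hε0 hε hΛ₁.le hb0.le hb
      (show constOfRecordH N F.L (ne3NperOfRecord₁₁ F 0 0) ℓ.g ≤ ℓ.C by rw [hCℓ, hgℓ])
  have hCε0 : 0 ≤ C * ℓ.ε := mul_nonneg hC hε0.le
  have hslot : LeafSlotHolderAT (ne3OfRecord₁₁ F oD) β :=
    leafSlotHolderAT_ofRecord_of_window_linear F oD hlen hlen1 hB₁' hBB hc₁' hwin hα hα1 hα2 hα3 hα4 hα5 hε hΛpos hΛ₂' hCε0 hCε hCε0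
      (hCε.trans (by linarith only [hα.le] : α / 2048 ≤ α / 24)) hT hP (leafH3sup_anti (h3 ℓ.ε hε0 hεε₀) (hD ℓ))
  exact ⟨ℓ, hgℓ, hΛ₁, hCℓ, hb0, hnum, hΛ₂'0, hreg, hslot, n16HolderAt_of_inEndRegimeH_leafSlotHolderAT hreg hβ0 hβ1 hslot⟩

/-- **★ THE SAME FROM `h5` AND [B11] THEOREM 1 AT leaf-06's TORUS INSTANCES** (`B = C.B₃`; data sets `D ℓ` inside the `(ℓ.ε∕C.B₃)`-ball): the producer module 43's
(β16) pin `N16PinnedLoose` wants, with the radius row free (take `D ℓ := {V ∈ record | V ∈ sfClass 4 F.L Nper (min (ℓ.ε∕C.B₃) ℓ.b) 0}` for N19's `hdom` side letter).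
NO `stub_h7`. [cite: Balaban1985Variational, Thm 1 (8)–(10) p.279] -/
theorem exists_letters_n16HolderAt_looseSub_of_h5_thm1At (F : T4Family) (hβ0 : 0 ≤ β) (hβ1 : β ≤ 1) {g : ℝ} (hg : 0 < g)
    (h5 : letI : CStarAlgebra (Matrix (Fin N) (Fin N) ℂ) := {}
      ∃ (len : Site 4 → ℝ) (c₁ c₁' B₁' cP C₂ B₀β : ℝ) (inp : B8.B9Inputs),
        (∀ v : Site 4, 0 < len v → 1 ≤ len v) ∧ (∀ μ : Fin 4, len (e μ) = 1) ∧ 0 < B₁' ∧ 5 * ((4 : ℕ) : ℝ) * F.L * inp.B₀ ≤ B₁' ∧ 0 < c₁' ∧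
        (∀ α₀ α₁ : ℝ, 0 < α₀ → 0 < α₁ → α₀ + α₁ ≤ c₁' →
          α₀ + α₁ ≤ c₁ ∧ C0 4 * (2 * α₀) ≤ 1 / 3 ∧ 4 * α₀ ≤ c2' 4 F.L ∧ 16 * (B₁' * (α₀ + α₁)) ≤ 1 ∧
          Real.exp (4 * (800 * (((4 : ℕ) : ℝ) + 1) ^ 2 * (((4 : ℕ) : ℝ) + 4)) * α₀) * (1 + 8 * (131072 * (((4 : ℕ) : ℝ) + 1) ^ 2) * (B₁' * (α₀ + α₁))) ≤ 2 ∧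
          2 * (B₁' * (α₀ + α₁)) ≤ c3 4 F.L ∧ ((4 : ℕ) : ℝ) * F.L * α₁ ≤ 1 / 8 ∧ α₀ ≤ cP ∧ α₁ ≤ cP ∧ B₁' * (α₀ + α₁) ≤ cP ∧
          2 * (B₁' * (α₀ + α₁)) ^ 2 + 20 * ((4 : ℕ) : ℝ) * α₀ * (B₁' * (α₀ + α₁)) + 2 * C₂ * (B₁' * (α₀ + α₁)) ^ 2 ≤ α₀ + α₁) ∧
        B8.Thm4Body c₁ B₁' (fun i : {i : ZdIdx 4 F.L // (∀ j, i.Ω j = Set.univ) ∧ (∀ m j, i.Λs m j = {_y | j = m}) ∧ (∀ m j, i.Λb m j = {_c | j = m}) ∧ i.η = ((F.L : ℝ)⁻¹) ^ i.k} => (zdGF3 (Matrix (Fin N) (Fin N) ℂ) F.L β len i.1).toGFData) ∧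
        B8.Prop3Body cP 4 (F.L : ℝ) C₂ inp B₀β (fun i : {i : ZdIdx 4 F.L // (∀ j, i.Ω j = Set.univ) ∧ (∀ m j, i.Λs m j = {_y | j = m}) ∧ (∀ m j, i.Λb m j = {_c | j = m}) ∧ i.η = ((F.L : ℝ)⁻¹) ^ i.k} => (zdGF3 (Matrix (Fin N) (Fin N) ℂ) F.L β len i.1).toGFData2))
    {G : (Site 4 → Fin 4 → (MatA N)ˣ) → Site 4 → ℕ → ℝ → ℝ → ℝ → Prop} (hGm : RadiiMono 4 G)
    (hG : ∀ (U : Site 4 → Fin 4 → (MatA N)ˣ) (x : Site 4) (K : ℕ) (α₀ α₁ α₂ : ℝ), 2 ≤ K → G U x K α₀ α₁ α₂ →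
      ∃ (u : Site 4 → (MatA N)ˣ) (a : Site 4 → Fin 4 → MatA N),
        (∀ z, u z ∈ unitaryUnits (MatA N)) ∧
        (∀ (y : Site 4) (τ : Fin 4), l1 (y - x) ≤ 2 → ((gaugeAct u U y τ : (MatA N)ˣ) : MatA N) = exp (a y τ)) ∧
        (∀ (y : Site 4) (τ : Fin 4), l1 (y - x) ≤ 2 → ‖a y τ‖ ≤ α₀) ∧
        (∀ (y : Site 4) (τ i : Fin 4), l1 (y - x) ≤ 1 → ‖fd i (fun z => a z τ) y‖ ≤ α₁) ∧
        (∀ (τ i l : Fin 4), ‖fd i (fd l (fun z => a z τ)) x‖ ≤ α₂))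
    (C : B11Thm1.Consts) (hM : ∀ e : ℝ, 0 < e → e ≤ C.a₁ → 7 / 2 ≤ C.Mfun e)
    (hT : ∀ k : ℕ, Thm1At C (torusVP 4 F.L (ne3NperOfRecord₁₁ F 0 0) G (k + 1)))
    (D : NE3Letters₁₁ → Set (Site 4 → Fin 4 → (MatA N)ˣ))
    (hD : ∀ ℓ : NE3Letters₁₁, D ℓ ⊆ {V | V ∈ ne3DomOfRecord₁₁ F N 0 0 ∧ V ∈ sfClass 4 F.L (ne3NperOfRecord₁₁ F 0 0) (ℓ.ε / C.B₃) 0}) :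
    ∃ ℓ : NE3Letters₁₁, ℓ.g = g ∧ ℓ.Λ₁ = radiusOfRecordH N F.L (ne3NperOfRecord₁₁ F 0 0) ∧ ℓ.C = constOfRecordH N F.L (ne3NperOfRecord₁₁ F 0 0) g ∧
      0 < ℓ.b ∧ 512 * (4 + 1) * (4 + 4) * (F.L : ℝ) ^ 2 * ℓ.b ≤ 1 ∧ 0 < ℓ.Λ₂' ∧
      InEndRegimeH (ne3OfRecord₁₁ F { ne3ConstLayerOfRecord₁₁ F N ℓ with dom := D ℓ }) ∧
      LeafSlotHolderAT (ne3OfRecord₁₁ F { ne3ConstLayerOfRecord₁₁ F N ℓ with dom := D ℓ }) β ∧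
      N16HolderAt (ne3OfRecord₁₁ F { ne3ConstLayerOfRecord₁₁ F N ℓ with dom := D ℓ }) β :=
  exists_letters_n16HolderAt_looseSub_of_edges F hβ0 hβ1 hg h5 D hD
    (h7Shape_loose_of_thm1At_torusVP (le_trans one_le_two (HistoryFlow.two_le_L F)) hGm hG C hM hT (ne3DomOfRecord₁₁ F N 0 0))

omit [NeZero N] in
/-- **THE (β16) RADIUS ROW INSTANCE**: data of record inside the `min(ℓ.ε∕C.B₃, ℓ.b)`-ball — a set inside the loose `(ℓ.ε∕C.B₃)`-ball
(`MinimalActionDictionary.sfClass_mono`), so §4 applies; and it lies inside `sfClass 4 F.L Nper ℓ.b 0` (node N19's `hdom ⊆ sfClass … ε₁ 0` with `ε₁ ≤ ℓ.b`). [folklore] -/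
theorem minBall_subset_loose_and_b (F : T4Family) (ℓ : NE3Letters₁₁) (B : ℝ) :
    {V : Site 4 → Fin 4 → (MatA N)ˣ | V ∈ ne3DomOfRecord₁₁ F N 0 0 ∧ V ∈ sfClass 4 F.L (ne3NperOfRecord₁₁ F 0 0) (min (ℓ.ε / B) ℓ.b) 0}
        ⊆ {V | V ∈ ne3DomOfRecord₁₁ F N 0 0 ∧ V ∈ sfClass 4 F.L (ne3NperOfRecord₁₁ F 0 0) (ℓ.ε / B) 0} ∧
      {V : Site 4 → Fin 4 → (MatA N)ˣ | V ∈ ne3DomOfRecord₁₁ F N 0 0 ∧ V ∈ sfClass 4 F.L (ne3NperOfRecord₁₁ F 0 0) (min (ℓ.ε / B) ℓ.b) 0}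
        ⊆ sfClass 4 F.L (ne3NperOfRecord₁₁ F 0 0) ℓ.b 0 :=
  ⟨fun _ hV => ⟨hV.1, MinimalActionDictionary.sfClass_mono (min_le_left _ _) hV.2⟩,
    fun _ hV => MinimalActionDictionary.sfClass_mono (min_le_right _ _) hV.2⟩

end LooseSub

end

end Summit.QuantumFields.YangMills.BalabanUVNodes.N16H7LooseOfThm1At
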